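import Summits.HubbardSuperconductivity.HubbardSuperconductivity.Theorems.AnisotropyChordTowerPerronZero
import Summits.HubbardSuperconductivity.HubbardSuperconductivity.Theorems.AnisotropyChordSectorAnchorXY
import Summits.HubbardSuperconductivity.HubbardSuperconductivity.Theorems.AnisotropyChordStiffnessOperatorLink

/-!
# Route `AnisotropyChord` / H0 rotor rung: THE HALF-FILLING ANCHOR AT THE XY POINT IS A TREE THEOREM, and the headline
# «XY-LM₀ alone ⇒ BEC for hard-core bosons on ℤ² near half filling» (work-order v11c of theory seat
# `hubbard-h0-rotor-theory-1`, cycle 11; director ruling 2026-08-28T13:48:19Z (a), (b))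

No new hypothesis is needed: the tree's `sectorAnchorXY_proof : SectorAnchorXY` (route item stmt-0977; Kennedy–Lieb–Shastry
in sector form: for even `M ≥ M₀` every normalised `Sᶻ_tot = 0` sector ground state `ψ` of `H_M(0)` has
`c·M⁴ ≤ Re⟨ψ, S⁺_tot S⁻_tot ψ⟩`) IS the anchor once `Re⟨ψ, S⁺S⁻ψ⟩ = lowerNormSq a = L⁴·condensateDensity a` for the Perron
amplitude (`Stiffness.star_dotProduct_raiseLower_toC`) and once one notes that a Perron amplitude of the sector `0` forces
`L` even (`even_of_perron_zero`).

* `even_of_perron_zero`, **`halfFillingAnchor_xy : ∃ c₀ > 0, HalfFillingAnchor 0 c₀`** (unconditional);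
* **`condensateOnBand_xy_of_minSpinAtZeroUpTo`** : `MinSpinAtZeroUpTo 0 ε → ∃ c₀ > 0, CondensateOnBand 0 (min(c₀/4,1/4)) (c₀/2 − ε)`
  and `condensateOnBand_xy_of_totalSpinMonotone` / `…_of_minSpinAtZero` — the XY analogue of Lieb–Mattis ordering ALONE
  gives Bose–Einstein condensation of hard-core bosons on `ℤ²` on a density band around half filling, the case Tasaki
  (arXiv:1807.05847, p. 7 §3.2) lists as expected but proved only at `M_L = 0`.  XY-LM₀ is OPEN («first lemma, print status
  under audit»); nothing here claims it.
-/

set_option linter.dupNamespace false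
set_option autoImplicit false

noncomputable section

open Finset Filter Topology Matrix
open Summit.HubbardSuperconductivity.HubbardSuperconductivity.Theorems.AnisotropyChord.InsertionEntropy
open Literature.MathematicalPhysics.QuantumLattice Literature.Probability.LatticeModels

namespace Summit.HubbardSuperconductivity.HubbardSuperconductivity.Theorems.AnisotropyChord.Tower

/-- A Perron ground amplitude of the sector `Sᶻ_tot = 0` exists only on EVEN tori (`L² = 2W`). [folklore] -/
theorem even_of_perron_zero (L : ℕ) [NeZero L] (Δ : ℝ) (a : TensorIndex (TorusSite 2 L) 2 → ℝ)
    (ha : IsPerronSectorGroundAmplitude L Δ 0 a) : Even L := by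
  set ψ : TensorIndex (TorusSite 2 L) 2 → ℂ := fun s => (a s : ℂ) with hψ
  have hψ0 : ψ ≠ 0 := by
    intro h0
    have hz : ∑ σ, a σ ^ 2 = 0 := Finset.sum_eq_zero fun σ _ => by
      have := congrFun h0 σ
      simp only [hψ, Pi.zero_apply, Complex.ofReal_eq_zero] at this
      rw [this]; ring
    rw [ha.unit] at hz
    exact one_ne_zero hz
  obtain ⟨W, -, hMW⟩ := exists_weight_of_mem_spinZSector ha.sector hψ0
  have hcard : Fintype.card (TorusSite 2 L) = L ^ 2 := by
    rw [Fintype.card_fun, ZMod.card, Fintype.card_fin]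
  rw [hcard] at hMW
  have h2 : ((L ^ 2 : ℕ) : ℝ) = 2 * (W : ℝ) := by push_cast at hMW ⊢; linarith
  have h3 : L ^ 2 = 2 * W := by exact_mod_cast h2
  have h4 : Even (L ^ 2) := ⟨W, by rw [h3]; ring⟩
  exact (Nat.even_pow' (by norm_num)).mp h4

/-- **THE HALF-FILLING ANCHOR AT `Δ = 0` (PROVED):** `∃ c₀ > 0, HalfFillingAnchor 0 c₀` — eventually in `L`, every Perron
amplitude of the half-filling sector of the hard-core boson / XY torus has condensate density `≥ c₀`.  Kennedy–Lieb–Shastry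
1988 in the tree's sector form (`sectorAnchorXY_proof`). [cite: KLS1988PRL, Theorem] -/
theorem halfFillingAnchor_xy : ∃ c₀ > (0 : ℝ), HalfFillingAnchor 0 c₀ := by
  obtain ⟨c, hc, M₀, hfloor⟩ := sectorAnchorXY_proof
  refine ⟨c, hc, ?_⟩
  unfold HalfFillingAnchor
  filter_upwards [eventually_ge_atTop M₀] with L hL
  intro _ a ha
  have hev : Even L := even_of_perron_zero L 0 a ha
  have hunit : star (Stiffness.toC L a) ⬝ᵥ Stiffness.toC L a = 1 := by
    unfold dotProduct Stiffness.toC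
    simp only [Pi.star_apply, RCLike.star_def, Complex.conj_ofReal]
    rw [show (∑ σ, (a σ : ℂ) * (a σ : ℂ)) = (((∑ σ, a σ ^ 2 : ℝ)) : ℂ) by push_cast; simp [sq], ha.unit]
    simp
  have h := hfloor L hev hL (Stiffness.toC L a) ha.sector hunit ha.eigen
  rw [Stiffness.star_dotProduct_raiseLower_toC, Complex.ofReal_re] at h
  have hcard : (Fintype.card (TorusSite 2 L) : ℝ) = (L : ℝ) ^ 2 := by
    rw [Fintype.card_fun, ZMod.card, Fintype.card_fin]; push_cast; ring
  have hL0 : (0 : ℝ) < (L : ℝ) := by exact_mod_cast Nat.pos_of_ne_zero (NeZero.ne L)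
  unfold condensateDensity
  rw [hcard, le_div_iff₀ (by positivity)]
  calc c * ((L : ℝ) ^ 2) ^ 2 = c * (L : ℝ) ^ 4 := by ring
    _ ≤ lowerNormSq a := h

/-- **HEADLINE (director ruling 2026-08-28T13:48:19Z (a), Δ = 0 corollary): XY-LM₀(ε) ALONE ⇒ BEC of hard-core bosons on
`ℤ²` on a band around half filling.**  `MinSpinAtZeroUpTo 0 ε → ∃ c₀ > 0, CondensateOnBand 0 (min(c₀/4,1/4)) (c₀/2 − ε)`:
eventually in `L`, every Perron amplitude of every integer sector `|M| ≤ min(c₀/4,1/4)·L²` of the XY torus has condensate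
density `≥ c₀/2 − ε`. Anchor: `halfFillingAnchor_xy`; support: `perronZeroOfInt_holds`. [folklore] -/
theorem condensateOnBand_xy_of_minSpinAtZeroUpTo (ε : ℝ) (h : MinSpinAtZeroUpTo 0 ε) :
    ∃ c₀ > (0 : ℝ), CondensateOnBand 0 (min (c₀ / 4) (1 / 4)) (c₀ / 2 - ε) := by
  obtain ⟨c₀, hc₀, hA⟩ := halfFillingAnchor_xy
  exact ⟨c₀, hc₀, condensateOnBand_of_minSpinAtZeroUpTo' 0 c₀ ε hc₀ h hA⟩

/-- Exact form: `MinSpinAtZero 0 → ∃ c₀ > 0, CondensateOnBand 0 (min(c₀/4,1/4)) (c₀/2)`. [folklore] -/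
theorem condensateOnBand_xy_of_minSpinAtZero (h : MinSpinAtZero 0) :
    ∃ c₀ > (0 : ℝ), CondensateOnBand 0 (min (c₀ / 4) (1 / 4)) (c₀ / 2) := by
  obtain ⟨c₀, hc₀, hA⟩ := halfFillingAnchor_xy
  exact ⟨c₀, hc₀, condensateOnBand_of_minSpinAtZero' 0 c₀ hc₀ h hA⟩

/-- Monotone form: `TotalSpinMonotone 0` (XY-Lieb–Mattis) `→ ∃ c₀ > 0, CondensateOnBand 0 (min(c₀/4,1/4)) (c₀/2)`. [folklore] -/
theorem condensateOnBand_xy_of_totalSpinMonotone (h : TotalSpinMonotone 0) :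
    ∃ c₀ > (0 : ℝ), CondensateOnBand 0 (min (c₀ / 4) (1 / 4)) (c₀ / 2) := by
  obtain ⟨c₀, hc₀, hA⟩ := halfFillingAnchor_xy
  exact ⟨c₀, hc₀, condensateOnBand_of_totalSpinMonotone' 0 c₀ hc₀ h hA⟩

end Summit.HubbardSuperconductivity.HubbardSuperconductivity.Theorems.AnisotropyChord.Tower
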